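import Summits.AtomisticToContinuum.HydrodynamicLimit.Theses.LambertianContactSwap
import Summits.AtomisticToContinuum.HydrodynamicLimit.Theorems.LambertianContactSwapLocalGibbsProbability
import Summits.AtomisticToContinuum.HydrodynamicLimit.Theorems.ImplosionDichotomyHydroLimitInBandEquilibrium
import Summits.AtomisticToContinuum.HydrodynamicLimit.Theorems.TwoClocksEntropyToHydro
import Literature.MathematicalPhysics.KineticTheory.LambertianHardSphereFlow
import HarnessLib

/-!
# `SwapGap` (stmt-AtomisticToContinuum-11850): the entropy transfer — `RelEntSwap → FieldConcentration → SwapGap`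

Helper file of the line `Sketch` (card `entropy-relative-to-lambertian-law`) for the crux
`Summit.AtomisticToContinuum.HydrodynamicLimit.Theses.LambertianContactSwap.SwapGap`: the COMPOSITION of
the line, proved unconditionally as an implication whose two hypotheses are the line's registered
stubs S1 (`RelEntSwap`) and S2 (`LambertianFieldConcentration`), written out in full.

Yau's relative entropy method with the COMPARISON GAS'S OWN LAW as reference (Yau 1991; Kipnis–Landim
1999 Ch. 6 §1 and App. 1 §8): with `μ_N := (Φ_N,t)_* P_N` (law at time `t` of the deterministic flow
started from the local Gibbs law `P_N`) and `ν_N := (Λ_N,t)_* (P_N ⊗ γ^ℕ)` (law of the Lambertian flow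
of the route from the same data), if `KL(μ_N ‖ ν_N)/(N+1) → 0` (S1) and every bounded `1`-Lipschitz
statistic `G = F ∘ fld(·, χ)` of the three `χ`-tested empirical fields of `Λ_t` concentrates around
its mean `m_N` at speed `N + 1` under `P_N ⊗ γ^ℕ` (S2), then the entropy inequality for events
(`tendsto_measure_of_klDiv_div_tendsto_zero`) gives `P_N{δ < |G(Φ_t z) − m_N|} → 0` for every `δ > 0`,
and boundedness (`tendsto_integral_sub_of_tendsto_measure`) gives `∫ G(Φ_t z) dP_N − m_N → 0`, which is
the conclusion of `SwapGap` (`m_N` is literally its Lambertian term: the route's inline `let` block is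
the Literature API `lambertFlow (Torus.geometry (Fin 3)) (hsDiameter σ N)` / `lambertNoise (Fin 3)`
definitionally). Thresholds `σ₀ := min (1/2) (min σ₁ σ₂)` (`P_N` is a probability measure for
`σ ≤ 1/2`, `isProbabilityMeasure_localGibbsLaw`; `Λ_t` is jointly measurable for `σ < 1/2`,
`measurable_lambertFlow_hsDiameter`).

prover-line-stmt-AtomisticToContinuum-11850-0, cycle 1.
-/

noncomputable section

open MeasureTheory Filter Set Topology InformationTheory
open scoped ENNReal

namespace Summit.AtomisticToContinuum.HydrodynamicLimit.Theorems

open Literature.Analysis.FluidPDE Literature.MathematicalPhysics.KineticTheory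
open Summit.AtomisticToContinuum.HydrodynamicLimit.Theses.LambertianContactSwap

/-! ### Plumbing -/

/-- **Convergence in probability towards moving centres gives merging of the means** (bounded case):
on probability spaces, if `|X_N| ≤ 1`, `|m_N| ≤ 1`, `X_N` is measurable and
`P_N{δ < |X_N − m_N|} → 0` for every `δ > 0`, then `∫ X_N dP_N − m_N → 0`. [folklore] -/
theorem tendsto_integral_sub_of_tendsto_measure {Ω : ℕ → Type*} [∀ N, MeasurableSpace (Ω N)]
    (P : (N : ℕ) → Measure (Ω N)) (hP : ∀ N, IsProbabilityMeasure (P N))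
    (X : (N : ℕ) → Ω N → ℝ) (hX : ∀ N, Measurable (X N)) (hXb : ∀ N ω, |X N ω| ≤ 1)
    (m : ℕ → ℝ) (hm : ∀ N, |m N| ≤ 1)
    (h : ∀ δ : ℝ, 0 < δ → Tendsto (fun N => P N {ω | δ < |X N ω - m N|}) atTop (𝓝 0)) :
    Tendsto (fun N => (∫ ω, X N ω ∂P N) - m N) atTop (𝓝 0) := by
  rw [Metric.tendsto_atTop]
  intro η hη
  have hδ : 0 < η / 4 := by positivity
  have hev := ENNReal.tendsto_nhds_zero.1 (h (η / 4) hδ) (ENNReal.ofReal (η / 4))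
    (ENNReal.ofReal_pos.2 hδ)
  rw [eventually_atTop] at hev
  obtain ⟨N₀, hN₀⟩ := hev
  refine ⟨N₀, fun N hN => ?_⟩
  haveI := hP N
  set S : Set (Ω N) := {ω | η / 4 < |X N ω - m N|}
  have hPS : (P N).real S ≤ η / 4 := ENNReal.toReal_le_of_le_ofReal hδ.le (hN₀ N hN)
  have hS : MeasurableSet S := measurableSet_lt measurable_const ((hX N).sub measurable_const).abs
  have hXi : Integrable (X N) (P N) :=
    Integrable.of_bound (hX N).aestronglyMeasurable 1 (ae_of_all _ fun ω => by
      rw [Real.norm_eq_abs]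
      exact hXb N ω)
  have hpt : ∀ ω, |X N ω - m N| ≤ S.indicator (fun _ => (2 : ℝ)) ω + η / 4 := by
    intro ω
    by_cases hω : η / 4 < |X N ω - m N|
    · have hmem : ω ∈ S := hω
      rw [Set.indicator_of_mem hmem]
      have h1 := hXb N ω
      have h2 := hm N
      have h3 : |X N ω - m N| ≤ |X N ω| + |m N| := abs_sub _ _
      linarith
    · have hmem : ω ∉ S := hω
      rw [Set.indicator_of_notMem hmem, zero_add]
      exact not_lt.1 hω
  rw [Real.dist_eq, sub_zero]
  have hint : (∫ ω, X N ω ∂P N) - m N = ∫ ω, (X N ω - m N) ∂P N := by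
    rw [integral_sub hXi (integrable_const _), integral_const, probReal_univ, one_smul]
  have hgi : Integrable (fun ω => S.indicator (fun _ => (2 : ℝ)) ω + η / 4) (P N) :=
    ((integrable_const (2 : ℝ)).indicator hS).add (integrable_const _)
  calc |(∫ ω, X N ω ∂P N) - m N| = |∫ ω, (X N ω - m N) ∂P N| := by rw [hint]
    _ ≤ ∫ ω, |X N ω - m N| ∂P N := abs_integral_le_integral_abs
    _ ≤ ∫ ω, (S.indicator (fun _ => (2 : ℝ)) ω + η / 4) ∂P N :=
        integral_mono_of_nonneg (ae_of_all _ fun ω => abs_nonneg _) hgi (ae_of_all _ hpt)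
    _ = 2 * (P N).real S + η / 4 := by
        rw [integral_add ((integrable_const (2 : ℝ)).indicator hS) (integrable_const _),
          integral_indicator_const _ hS, integral_const, probReal_univ, smul_eq_mul, smul_eq_mul,
          mul_comm, one_mul]
    _ < η := by linarith

/-- The triple of `χ`-tested empirical fields is measurable in the configuration (continuous `χ`).
[folklore] -/
theorem measurable_fieldTriple {N : ℕ} {χ : T3 → ℝ} (hχ : Continuous χ) :
    Measurable fun z : Config N (Fin 3) T3 =>
      (empiricalDensityField z χ, empiricalMomentumField z χ, empiricalEnergyField z χ) :=
  (measurable_empiricalDensityField hχ).prodMk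
    ((measurable_empiricalMomentumField hχ).prodMk (measurable_empiricalEnergyField hχ))

/-! ### The transfer -/

/-- **`SwapGap` from `RelEntSwap` (S1) and `LambertianFieldConcentration` (S2)** — the composition of
line `Sketch` of the crux, as an unconditional implication:
with `σ₀ := min (1/2) (min σ₁ σ₂)`, for `σ < σ₀`, Euler data, flows, the `t = 0` hypothesis,
`t < T`, `χ`, `F`: put `G := F ∘ fld(·, χ)` (measurable, `|G| ≤ 1`),
`μ_N := (Φ_N,t)_* P_N`, `ν_N := (Λ_N,t)_* (P_N ⊗ γ^ℕ)` (probability measures; `Λ` jointly measurable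
for `σ < 1/2`, `measurable_lambertFlow_hsDiameter`), `m_N := ∫ G dν_N`. S2 gives
`ν_N{δ < |G − m_N|} ≤ C e^{−(N+1)/C}`, S1 gives `KL(μ_N‖ν_N)/(N+1) → 0`, so the entropy inequality for
events (`tendsto_measure_of_klDiv_div_tendsto_zero`) gives `μ_N{δ < |G − m_N|} → 0`, i.e.
`P_N{δ < |G(Φ_t z) − m_N|} → 0` for every `δ > 0`; boundedness
(`tendsto_integral_sub_of_tendsto_measure`) gives `∫ G(Φ_t z) dP_N − m_N → 0`, which is the crux
(`m_N` is literally its Lambertian term). [cite: KipnisLandim1999, Ch. 6 §1] -/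
theorem swapGap_of_relEntSwap_of_fieldConcentration
    (h1 : ∀ (a₀ θ₀ : T3 → ℝ) (u₀ : T3 → V3), Continuous a₀ → Continuous θ₀ → Continuous u₀ →
      (∀ x, 0 < a₀ x) → (∀ x, 0 < θ₀ x) →
      ∃ σ₀ : ℝ, 0 < σ₀ ∧ ∀ σ : ℝ, 0 < σ → σ < σ₀ →
        ∀ (T : ℝ) (ρ θ : ℝ → T3 → ℝ) (u : ℝ → T3 → V3), IsHardSphereEulerSolution σ T ρ u θ →
          ∀ Φ : (N : ℕ) → HardSphereFlow (Torus.geometry (Fin 3)) (hsDiameter σ N) (N + 1),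
            TendstoHydroFieldsAt (fun N => localGibbsLaw σ a₀ u₀ θ₀ N (Φ N)) Φ ρ u θ 0 →
              ∀ t ∈ Set.Ico 0 T,
                Tendsto (fun N : ℕ =>
                  klDiv ((localGibbsLaw σ a₀ u₀ θ₀ N (Φ N)).map ((Φ N).flow t))
                    (((localGibbsLaw σ a₀ u₀ θ₀ N (Φ N)).prod (lambertNoise (Fin 3))).map
                      (fun p => lambertFlow (Torus.geometry (Fin 3)) (hsDiameter σ N) p.2 p.1 t)) /
                  ((N : ℝ≥0∞) + 1)) atTop (𝓝 0))
    (h2 : ∀ (a₀ θ₀ : T3 → ℝ) (u₀ : T3 → V3), Continuous a₀ → Continuous θ₀ → Continuous u₀ →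
      (∀ x, 0 < a₀ x) → (∀ x, 0 < θ₀ x) →
      ∃ σ₀ : ℝ, 0 < σ₀ ∧ ∀ σ : ℝ, 0 < σ → σ < σ₀ →
        ∀ (T : ℝ) (ρ θ : ℝ → T3 → ℝ) (u : ℝ → T3 → V3), IsHardSphereEulerSolution σ T ρ u θ →
          ∀ Φ : (N : ℕ) → HardSphereFlow (Torus.geometry (Fin 3)) (hsDiameter σ N) (N + 1),
            TendstoHydroFieldsAt (fun N => localGibbsLaw σ a₀ u₀ θ₀ N (Φ N)) Φ ρ u θ 0 →
              ∀ t ∈ Set.Ico 0 T, ∀ χ : T3 → ℝ, Continuous χ →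
                ∀ F : ℝ × V3 × ℝ → ℝ, LipschitzWith 1 F → (∀ y, |F y| ≤ 1) → ∀ δ : ℝ, 0 < δ →
                  ∃ C : ℝ, 0 < C ∧ ∀ N : ℕ,
                    ((localGibbsLaw σ a₀ u₀ θ₀ N (Φ N)).prod (lambertNoise (Fin 3)))
                      {p | δ < |F (empiricalDensityField
                              (lambertFlow (Torus.geometry (Fin 3)) (hsDiameter σ N) p.2 p.1 t) χ,
                            empiricalMomentumField
                              (lambertFlow (Torus.geometry (Fin 3)) (hsDiameter σ N) p.2 p.1 t) χ,
                            empiricalEnergyField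
                              (lambertFlow (Torus.geometry (Fin 3)) (hsDiameter σ N) p.2 p.1 t) χ) -
                          ∫ q, F (empiricalDensityField
                              (lambertFlow (Torus.geometry (Fin 3)) (hsDiameter σ N) q.2 q.1 t) χ,
                            empiricalMomentumField
                              (lambertFlow (Torus.geometry (Fin 3)) (hsDiameter σ N) q.2 q.1 t) χ,
                            empiricalEnergyField
                              (lambertFlow (Torus.geometry (Fin 3)) (hsDiameter σ N) q.2 q.1 t) χ)
                            ∂((localGibbsLaw σ a₀ u₀ θ₀ N (Φ N)).prod (lambertNoise (Fin 3)))|} ≤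
                      ENNReal.ofReal (C * Real.exp (-(C⁻¹ * ((N : ℝ) + 1))))) :
    SwapGap := by
  delta Summit.AtomisticToContinuum.HydrodynamicLimit.Theses.LambertianContactSwap.SwapGap
  intro Cfg G ε τ S ldir lpair lstep lstate linst lflow noise fld a₀ θ₀ u₀ ha hθ hu ha0 hθ0
  obtain ⟨σ₁, hσ₁, h1'⟩ := h1 a₀ θ₀ u₀ ha hθ hu ha0 hθ0
  obtain ⟨σ₂, hσ₂, h2'⟩ := h2 a₀ θ₀ u₀ ha hθ hu ha0 hθ0
  refine ⟨min 2⁻¹ (min σ₁ σ₂), lt_min (by norm_num) (lt_min hσ₁ hσ₂), ?_⟩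
  intro σ hσ hσlt T ρ θ u hE Φ P h0 t ht χ hχ F hF hF1
  have hσhalf : σ < 2⁻¹ := hσlt.trans_le (min_le_left _ _)
  have hσ₁' : σ < σ₁ := hσlt.trans_le ((min_le_right _ _).trans (min_le_left _ _))
  have hσ₂' : σ < σ₂ := hσlt.trans_le ((min_le_right _ _).trans (min_le_right _ _))
  -- the laws
  have hPN : ∀ N, IsProbabilityMeasure (P N) := fun N =>
    isProbabilityMeasure_localGibbsLaw ha hθ hu ha0 hθ0 (by linarith) N (Φ N)
  have hnoise : IsProbabilityMeasure noise := by
    show IsProbabilityMeasure (lambertNoise (Fin 3))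
    infer_instance
  -- measurability of the Lambertian flow (the `let` block is the Literature API definitionally)
  have hΛ : ∀ N, Measurable fun p : Cfg N × (ℕ → EuclideanSpace ℝ (Fin 3)) => lflow σ N p.2 p.1 t :=
    fun N => measurable_lambertFlow_hsDiameter hσ.le hσhalf N t
  -- the bounded measurable statistic `G_N = F ∘ fld`
  have hfld : ∀ N, Measurable fun y : Cfg N => fld N y χ := fun N => measurable_fieldTriple hχ
  have hG : ∀ N, Measurable fun y : Cfg N => F (fld N y χ) :=
    fun N => hF.continuous.measurable.comp (hfld N)
  -- the two image laws
  set μ : (N : ℕ) → Measure (Cfg N) := fun N => (P N).map ((Φ N).flow t) with hμ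
  set ν : (N : ℕ) → Measure (Cfg N) := fun N =>
    ((P N).prod noise).map (fun p => lflow σ N p.2 p.1 t) with hν
  haveI hμfin : ∀ N, IsFiniteMeasure (μ N) := fun N => by
    haveI := hPN N
    exact Measure.isFiniteMeasure_map _ _
  haveI hνfin : ∀ N, IsFiniteMeasure (ν N) := fun N => by
    haveI := hPN N
    exact Measure.isFiniteMeasure_map _ _
  -- the Lambertian means
  set m : ℕ → ℝ := fun N => ∫ p, F (fld N (lflow σ N p.2 p.1 t) χ) ∂((P N).prod noise) with hm
  have hm1 : ∀ N, |m N| ≤ 1 := fun N => by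
    haveI := hPN N
    have h := norm_integral_le_of_norm_le_const (μ := (P N).prod noise)
      (f := fun p : Cfg N × (ℕ → EuclideanSpace ℝ (Fin 3)) => F (fld N (lflow σ N p.2 p.1 t) χ))
      (C := 1) (ae_of_all _ fun p => by
        rw [Real.norm_eq_abs]
        exact hF1 _)
    simpa [hm, Real.norm_eq_abs] using h
  -- S1: `KL(μ_N ‖ ν_N)/(N+1) → 0`
  have hkl : Tendsto (fun N : ℕ => klDiv (μ N) (ν N) / ((N : ℝ≥0∞) + 1)) atTop (𝓝 0) :=
    h1' σ hσ hσ₁' T ρ θ u hE Φ h0 t ht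
  -- convergence in `P_N`-probability of `G(Φ_t z)` towards the Lambertian mean
  have hprob : ∀ δ : ℝ, 0 < δ →
      Tendsto (fun N => P N {z | δ < |F (fld N ((Φ N).flow t z) χ) - m N|}) atTop (𝓝 0) := by
    intro δ hδ
    obtain ⟨C, hC, hconc⟩ := h2' σ hσ hσ₂' T ρ θ u hE Φ h0 t ht χ hχ F hF hF1 δ hδ
    set A : (N : ℕ) → Set (Cfg N) := fun N => {y | δ < |F (fld N y χ) - m N|} with hA
    have hAm : ∀ N, MeasurableSet (A N) := fun N =>
      measurableSet_lt measurable_const ((hG N).sub measurable_const).abs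
    have hνA : ∀ N, ν N (A N) ≤ ENNReal.ofReal (C * Real.exp (-(C⁻¹ * ((N : ℝ) + 1)))) := by
      intro N
      rw [hν, Measure.map_apply (hΛ N) (hAm N)]
      exact hconc N
    have hμA := tendsto_measure_of_klDiv_div_tendsto_zero μ ν A hC hνA hkl
    refine hμA.congr fun N => ?_
    rw [hμ, Measure.map_apply ((Φ N).measurable_flow t) (hAm N)]
    rfl
  -- merging of the means
  have hmerge := tendsto_integral_sub_of_tendsto_measure P hPN
    (fun N z => F (fld N ((Φ N).flow t z) χ)) (fun N => (hG N).comp ((Φ N).measurable_flow t))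
    (fun N z => hF1 _) m hm1 hprob
  exact hmerge

end Summit.AtomisticToContinuum.HydrodynamicLimit.Theorems
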